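import Literature.NumberTheory.EllipticCurves.ShaPrimaryModDivisibleSquare
import Literature.NumberTheory.EllipticCurves.ZpCorankLowerBoundOfTorsionLevels
import Literature.GroupTheory.FiniteAbelian.SymplecticModules
import Literature.Algebra.Module.AlternatingPairingParity
import HarnessLib

/-!
# The level profile of a symplectic cofinite `p`-primary group: `#A[p^e] = p^{e·ρ + 2 m_e}`

Topic `Literature/NumberTheory/EllipticCurves`, family `bsd`. Pure group theory (theorems only, all
proved, no definition, no named fact) around the tree's corank formula
`Literature.NumberTheory.EllipticCurves.zpCorank A p = dim_{𝔽_p} A[p] − dim_{𝔽_p} A/pA` (files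
`Selmer`, `ZpCorankStable`, `ZpCorankLowerBoundOfTorsionLevels`, `ShaPrimaryModDivisibleSquare`),
completing the sentence "classically `A ≅ (ℚ_p/ℤ_p)^ρ ⊕ M ⊕ M`" of `ShaPrimaryModDivisibleSquare`
into a COUNT AT EVERY LEVEL `p^e`, which is what an `e`-fold descent reads.

Let `A` be a `p`-primary abelian group with finite `A[p]` carrying a bi-additive alternating pairing
`B : A × A → ℚ/ℤ` whose left kernel lies in `⋂_k p^k A` (the shape in which the Cassels–Tate
pairing restricts to `Ш(E/K)[p^∞]`, `exists_pairing_primaryComponent_sha`). Write `ρ = zpCorank A p`.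

* `exists_levelProfile_of_pairing` (**the level profile**): there is `m : ℕ → ℕ` with `m 0 = 0`,
  `m` monotone and eventually constant, and **`#A[p^e] = p ^ (e·ρ + 2·m e)` for every `e`**.
  Proof: with `k₀` a stability index of `A[p] ∩ p^k A` (`exists_torsionBy_inf_range_stable`),
  `D = p^{k₀} A` is divisible and equals `A_div` (`range_nsmul_pow_eq_divisibleElements_of_stable`),
  so `0 → D[p^e] → A[p^e] → (A/D)[p^e] → 0` is exact (`natCard_torsionBy_eq_mul` at `p^e`) and
  `#D[p^e] = (#D[p])^e = p^{eρ}` (`natCard_torsionBy_pow_eq_pow_of_pDivisible`,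
  `pow_zpCorank_eq_natCard_torsionBy_inf_range_of_stable`); `B` descends to a nondegenerate
  alternating pairing on the finite group `T = A/D` (`exists_quotient_pairing`), so `T ≃ L × L`
  (Wall 1963 / Tignol–Amitsur 1986, tree `Literature.GroupTheory.FiniteAbelian.exists_addEquiv_prod_self`)
  and `#T[p^e] = (#L[p^e])² = p^{2 m_e}`.
* Helpers of independent use: `natCard_torsionBy_congr_natCast` (transport along `≃+`),
  `natCard_torsionBy_prod` (`#(X × Y)[n] = #X[n]·#Y[n]`), `exists_natCard_eq_prime_pow_of_primary`
  (a finite `p`-primary additive group has order `p^m`, via Mathlib `IsPGroup.iff_card`),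
  `natCard_torsionBy_pow_succ_le` (**`#X[p^{e+1}] ≤ #X[p^e] · #X[p]`** for every abelian group with
  finite `p`-torsion: multiplication by `p^e` maps `X[p^{e+1}]` into `X[p]` with kernel `X[p^e]`),
  `le_torsionBy_of_torsionBy_succ_eq` (**stabilisation is final**: in a `p`-primary group,
  `X[p^{e+1}] = X[p^e]` forces `X = X[p^e]`).

The arithmetic consequences for `A = Ш(E/K)[p^∞]` (the profile `#Ш[p^e] = p^{e·t_p + 2m_e}`, the
second-descent door, the `(p, p²)` reading table) are in the sibling `ShaPrimaryLevelProfile.lean`.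

## References

* R. Greenberg, *Iwasawa theory for elliptic curves*, LNM 1716 (1999), §1, pp. 54–57 (cofinitely
  generated `p`-primary groups `(ℚ_p/ℤ_p)^ρ ⊕ (finite)`). [Greenberg1999LNM]
* C. T. C. Wall, *Quadratic forms on finite groups, and related topics*, Topology 2 (1963), Lemma 7
  (a finite symplectic module is `L × L`). [Wall1963QuadraticFormsFiniteGroups]
* T. Dokchitser, *Notes on the parity conjecture* (2013), §2 ("`Ш[p^∞] ≅ (ℚ_p/ℤ_p)^{δ_p} ×` (finite
  group of square order)"). [Dokchitser2013ParityNotes]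
  Otherwise [folklore].
-/

noncomputable section

open scoped Classical
open scoped AddSubgroup
open Literature.GroupTheory.FiniteAbelian Literature.Algebra.Module

namespace Literature.NumberTheory.EllipticCurves

universe u

/-! ### Counting helpers for `n`-torsion -/

section Helpers

variable {X Y : Type*} [AddCommGroup X] [AddCommGroup Y]

/-- `#X[n] = #Y[n]` for isomorphic abelian groups `X ≃+ Y` (the subgroups `A[n] = {a : na = 0}` of
Fuchs, *Infinite Abelian Groups* I, Ch. I §1, are functorial). [cite: Fuchs1970, Ch. I §1 (the subgroups `A[n]`)] -/
theorem natCard_torsionBy_congr_natCast (f : X ≃+ Y) (n : ℕ) :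
    Nat.card (X[(n : ℤ)]) = Nat.card (Y[(n : ℤ)]) := by
  refine Nat.card_congr
    { toFun := fun x ↦ ⟨f x, AddSubgroup.torsionBy.nsmul_iff.mpr (by
        rw [← map_nsmul, AddSubgroup.torsionBy.nsmul_iff.mp x.2, map_zero])⟩
      invFun := fun y ↦ ⟨f.symm y, AddSubgroup.torsionBy.nsmul_iff.mpr (by
        rw [← map_nsmul, AddSubgroup.torsionBy.nsmul_iff.mp y.2, map_zero])⟩
      left_inv := fun x ↦ Subtype.ext (f.symm_apply_apply x)
      right_inv := fun y ↦ Subtype.ext (f.apply_symm_apply y) }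

/-- `#(X × Y)[n] = #X[n] · #Y[n]`: the `n`-torsion of a direct sum is the direct sum of the `n`-torsions
(Fuchs, *Infinite Abelian Groups* I, Ch. I §1 and §8). [cite: Fuchs1970, Ch. I §8 (direct sums; `(⊕ A_i)[n] = ⊕ A_i[n]`)] -/
theorem natCard_torsionBy_prod (n : ℕ) :
    Nat.card ((X × Y)[(n : ℤ)]) = Nat.card (X[(n : ℤ)]) * Nat.card (Y[(n : ℤ)]) := by
  rw [← Nat.card_prod]
  refine Nat.card_congr
    { toFun := fun z ↦ (⟨z.1.1, AddSubgroup.torsionBy.nsmul_iff.mpr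
          (congrArg Prod.fst (AddSubgroup.torsionBy.nsmul_iff.mp z.2))⟩,
        ⟨z.1.2, AddSubgroup.torsionBy.nsmul_iff.mpr
          (congrArg Prod.snd (AddSubgroup.torsionBy.nsmul_iff.mp z.2))⟩)
      invFun := fun w ↦ ⟨(w.1, w.2), AddSubgroup.torsionBy.nsmul_iff.mpr (Prod.ext
          (by rw [Prod.smul_fst, Prod.fst_zero]; exact AddSubgroup.torsionBy.nsmul_iff.mp w.1.2)
          (by rw [Prod.smul_snd, Prod.snd_zero]; exact AddSubgroup.torsionBy.nsmul_iff.mp w.2.2))⟩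
      left_inv := fun z ↦ Subtype.ext rfl
      right_inv := fun w ↦ Prod.ext (Subtype.ext rfl) (Subtype.ext rfl) }

/-- The `1`-torsion subgroup is trivial: `#X[1] = 1`. [folklore] -/
private theorem natCard_torsionBy_one_eq_one : Nat.card (X[((1 : ℕ) : ℤ)]) = 1 := by
  haveI : Subsingleton (X[((1 : ℕ) : ℤ)]) := ⟨fun x y ↦ Subtype.ext (by
    have hx : (1 : ℕ) • (x : X) = 0 := AddSubgroup.torsionBy.nsmul_iff.mp x.2
    have hy : (1 : ℕ) • (y : X) = 0 := AddSubgroup.torsionBy.nsmul_iff.mp y.2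
    rw [one_smul] at hx hy
    rw [hx, hy])⟩
  exact Nat.card_unique

/-- `X[p^e] ≤ X[p^{e'}]` for `e ≤ e'` (the ascending chain `A[p] ≤ A[p²] ≤ ⋯` of Fuchs, Ch. I §1).
[cite: Fuchs1970, Ch. I §1 (the subgroups `A[n]`)] -/
theorem torsionBy_pow_mono (p : ℕ) {e e' : ℕ} (h : e ≤ e') :
    X[((p ^ e : ℕ) : ℤ)] ≤ X[((p ^ e' : ℕ) : ℤ)] := by
  intro x hx
  obtain ⟨i, rfl⟩ := Nat.exists_eq_add_of_le h
  rw [AddSubgroup.torsionBy.nsmul_iff] at hx ⊢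
  rw [pow_add, mul_comm, ← smul_smul, hx, smul_zero]

/-- **A finite `p`-primary additive group has order a power of `p`** (a finite group all of whose
elements have `p`-power order has order `p^m`, by Cauchy's theorem; Lang, *Algebra*, Ch. I §6), via
Mathlib's `IsPGroup.iff_card` through `Multiplicative`. [cite: Lang2002, Ch. I §6 (Sylow subgroups; Cauchy's theorem)] -/
theorem exists_natCard_eq_prime_pow_of_primary (p : ℕ) [Fact p.Prime] [Finite X]
    (hX : ∀ x : X, ∃ n : ℕ, p ^ n • x = 0) : ∃ m : ℕ, Nat.card X = p ^ m := by
  have hG : IsPGroup p (Multiplicative X) := fun g ↦ by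
    obtain ⟨k, hk⟩ := hX (Multiplicative.toAdd g)
    refine ⟨k, ?_⟩
    rw [← ofAdd_toAdd g, ← ofAdd_nsmul, hk, ofAdd_zero]
  obtain ⟨m, hm⟩ := IsPGroup.iff_card.mp hG
  exact ⟨m, by rw [← hm]; exact Nat.card_congr Multiplicative.ofAdd⟩

/-- **`#X[p^{e+1}] ≤ #X[p^e] · #X[p]`** for every abelian group with finite `p`-torsion: multiplication
by `p^e` maps `X[p^{e+1}]` into `X[p]` with kernel `X[p^e]`. So one further level of descent raises the
exponent of `#X[p^·]` by at most `dim_{𝔽_p} X[p]` (Fuchs, Ch. I §1–§3: `p^e A[p^{e+1}] ≤ A[p]`).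
[cite: Fuchs1970, Ch. I §1 (the subgroups `A[n]`, `nA`)] -/
theorem natCard_torsionBy_pow_succ_le (p : ℕ) [Finite X[(p : ℤ)]] (e : ℕ) :
    Nat.card (X[((p ^ (e + 1) : ℕ) : ℤ)]) ≤ Nat.card (X[((p ^ e : ℕ) : ℤ)]) * Nat.card (X[(p : ℤ)]) := by
  haveI : Finite (X[((p ^ (e + 1) : ℕ) : ℤ)]) := finite_torsionBy_pow X p (e + 1)
  haveI : Finite (X[((p ^ e : ℕ) : ℤ)]) := finite_torsionBy_pow X p e
  -- multiplication by `p^e`: `X[p^{e+1}] → X[p]`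
  let ψ : X[((p ^ (e + 1) : ℕ) : ℤ)] →+ X[(p : ℤ)] :=
    ((nsmulAddMonoidHom (p ^ e)).comp (X[((p ^ (e + 1) : ℕ) : ℤ)]).subtype).codRestrict _ fun x ↦
      AddSubgroup.torsionBy.nsmul_iff.mpr (by
        change p • (p ^ e) • (x : X) = 0
        rw [smul_smul, ← pow_succ', ← AddSubgroupClass.coe_nsmul, AddSubgroup.torsionBy.nsmul x,
          ZeroMemClass.coe_zero])
  have hψ : ∀ x, ((ψ x : X[(p : ℤ)]) : X) = (p ^ e) • (x : X) := fun _ ↦ rfl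
  -- its kernel embeds in `X[p^e]`
  have hker : Nat.card ψ.ker ≤ Nat.card (X[((p ^ e : ℕ) : ℤ)]) := by
    refine Nat.card_le_card_of_injective
      (fun x : ψ.ker ↦ (⟨((x : X[((p ^ (e + 1) : ℕ) : ℤ)]) : X),
        AddSubgroup.torsionBy.nsmul_iff.mpr (by
          have h := congrArg (fun z : X[(p : ℤ)] ↦ (z : X)) (AddMonoidHom.mem_ker.mp x.2)
          rw [hψ] at h
          simpa using h)⟩ : X[((p ^ e : ℕ) : ℤ)])) ?_
    intro x y hxy
    have h1 := congrArg (fun z : X[((p ^ e : ℕ) : ℤ)] ↦ (z : X)) hxy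
    exact Subtype.ext (Subtype.ext (by simpa using h1))
  have hrange : Nat.card ψ.range ≤ Nat.card (X[(p : ℤ)]) := AddSubgroup.card_le_of_le le_top |>.trans_eq
    AddSubgroup.card_top
  rw [natCard_eq_card_ker_mul_card_range ψ]
  exact Nat.mul_le_mul hker hrange

/-- **Stabilisation is final.** In a `p`-primary group, if `X[p^{e+1}] = X[p^e]` then `X = X[p^e]`:
an element killed by `p^n` with `n > e` has `p^{n-e-1} •` it in `X[p^{e+1}] = X[p^e]`, so it is
already killed by `p^{n-1}`. (The CT-free half of the second-descent door.)
[cite: Fuchs1970, Ch. I §1 (the subgroups `A[n]`; `p`-groups)] -/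
theorem le_torsionBy_of_torsionBy_succ_eq (p : ℕ) (hX : ∀ x : X, ∃ n : ℕ, p ^ n • x = 0) {e : ℕ}
    (h : X[((p ^ (e + 1) : ℕ) : ℤ)] = X[((p ^ e : ℕ) : ℤ)]) : ∀ x : X, x ∈ X[((p ^ e : ℕ) : ℤ)] := by
  -- every `x` killed by `p^n` is killed by `p^e`, by induction on `n`
  have key : ∀ n : ℕ, ∀ x : X, p ^ n • x = 0 → p ^ e • x = 0 := by
    intro n
    induction n with
    | zero =>
      intro x hx
      rw [pow_zero, one_smul] at hx
      rw [hx, smul_zero]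
    | succ n ih =>
      intro x hx
      by_cases hn : n + 1 ≤ e
      · obtain ⟨i, hi⟩ := Nat.exists_eq_add_of_le hn
        rw [hi, pow_add, mul_comm, ← smul_smul, hx, smul_zero]
      · -- `n ≥ e`: `y = p^(n-e) • x ∈ X[p^(e+1)] = X[p^e]`, so `p^n • x = 0`; apply `ih`
        have hne : e ≤ n := by omega
        obtain ⟨i, hi⟩ := Nat.exists_eq_add_of_le hne
        have hy : p ^ i • x ∈ X[((p ^ (e + 1) : ℕ) : ℤ)] := by
          rw [AddSubgroup.torsionBy.nsmul_iff, smul_smul, ← pow_add]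
          have : e + 1 + i = n + 1 := by omega
          rw [this, hx]
        rw [h, AddSubgroup.torsionBy.nsmul_iff, smul_smul, ← pow_add] at hy
        have : e + i = n := by omega
        rw [this] at hy
        exact ih x hy
  intro x
  obtain ⟨n, hn⟩ := hX x
  exact AddSubgroup.torsionBy.nsmul_iff.mpr (key n x hn)

end Helpers

/-! ### The level profile -/

section Profile

variable {A : Type u} [AddCommGroup A] (p : ℕ) [hp : Fact p.Prime]

/-- **The level profile of a symplectic cofinite `p`-primary group.** Let `A` be `p`-primary with
`A[p]` finite, carrying a bi-additive alternating `B : A × A → ℚ/ℤ` whose left kernel lies in every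
`p^k A`. Then there is a function `m : ℕ → ℕ`, with `m 0 = 0`, monotone and eventually constant, such
that **`#A[p^e] = p ^ (e · zpCorank A p + 2 · m e)` for every `e`** — the count of the decomposition
`A ≅ (ℚ_p/ℤ_p)^ρ ⊕ L ⊕ L` (`p^{m_e} = #L[p^e]`). Greenberg, LNM 1716, §1; Wall 1963, Lemma 7.
[cite: Greenberg1999LNM, §1 (pp. 54–57)] [cite: Wall1963QuadraticFormsFiniteGroups, Lemma 7] -/
theorem exists_levelProfile_of_pairing (hA : ∀ a : A, ∃ n : ℕ, p ^ n • a = 0) [Finite A[(p : ℤ)]]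
    (B : A →+ A →+ AddCircle (1 : ℚ)) (halt : ∀ a, B a a = 0)
    (hker : ∀ a, (∀ b, B a b = 0) → ∀ k : ℕ, a ∈ (nsmulAddMonoidHom (α := A) (p ^ k)).range) :
    ∃ m : ℕ → ℕ, m 0 = 0 ∧ Monotone m ∧ (∃ e₀ : ℕ, ∀ e, e₀ ≤ e → m e = m e₀) ∧
      ∀ e : ℕ, Nat.card (A[((p ^ e : ℕ) : ℤ)]) = p ^ (e * zpCorank A p + 2 * m e) := by
  obtain ⟨k₀, hst⟩ := exists_torsionBy_inf_range_stable (A := A) p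
  obtain ⟨hdivall, -⟩ := range_nsmul_pow_eq_divisibleElements_of_stable p hA hst
  set C : AddSubgroup A := (nsmulAddMonoidHom (α := A) (p ^ k₀)).range with hC
  -- `C` is `n`-divisible for every `n ≥ 1`
  have hDn : ∀ n : ℕ, 0 < n → ∀ d : C, ∃ d' : C, n • d' = d := fun n hn d ↦ by
    obtain ⟨d', hd', h⟩ := hdivall d d.2 n hn
    exact ⟨⟨d', hd'⟩, Subtype.ext h⟩
  have hD : ∀ d : C, ∃ d' : C, p • d' = d := hDn p hp.out.pos
  -- `B` vanishes on `C × A` and `A × C`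
  have hC₁ : ∀ c ∈ C, ∀ b, B c b = 0 := by
    intro c hc b
    obtain ⟨n, hn⟩ := hA b
    obtain ⟨c', -, rfl⟩ := hdivall c hc (p ^ n) (pow_pos hp.out.pos n)
    rw [map_nsmul, AddMonoidHom.nsmul_apply, ← map_nsmul, hn, map_zero]
  have hC₂ : ∀ a, ∀ c ∈ C, B a c = 0 := fun a c hc ↦ by
    rw [eq_neg_of_alternating B halt, hC₁ c hc a, neg_zero]
  -- the quotient `T = A / C` and its nondegenerate alternating pairing
  obtain ⟨B', hB'⟩ := exists_quotient_pairing C B hC₁ hC₂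
  have hB'alt : ∀ z, B' z z = 0 := by
    intro z
    induction z using QuotientAddGroup.induction_on with
    | H a => rw [hB', halt]
  have hB'nd : ∀ z, (∀ w, B' z w = 0) → z = 0 := by
    intro z hz
    induction z using QuotientAddGroup.induction_on with
    | H a =>
      rw [QuotientAddGroup.eq_zero_iff, hC]
      exact hker a (fun b ↦ by rw [← hB', hz]) k₀
  -- exactness data of `0 → C → A → T → 0`
  have hi : Function.Injective C.subtype := C.subtype_injective
  have hf : Function.Surjective (QuotientAddGroup.mk' C) := QuotientAddGroup.mk'_surjective C
  have hex : ∀ a, QuotientAddGroup.mk' C a = 0 → a ∈ C.subtype.range := fun a ha ↦ by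
    rw [AddSubgroup.range_subtype]; exact (QuotientAddGroup.eq_zero_iff a).mp ha
  have hfi : ∀ d : C, QuotientAddGroup.mk' C (C.subtype d) = 0 := fun d ↦
    (QuotientAddGroup.eq_zero_iff _).mpr d.2
  -- `T` is finite: `T[p]` is the image of `A[p]` and `p^{k₀} T = 0`
  haveI : Finite (A ⧸ C)[(p : ℤ)] :=
    Finite.of_surjective _ (torsionByMap_surjective (p := p) hf hex hfi hD)
  have hTk₀ : ∀ z : A ⧸ C, p ^ k₀ • z = 0 := by
    intro z
    induction z using QuotientAddGroup.induction_on with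
    | H a =>
      rw [← QuotientAddGroup.mk_nsmul, QuotientAddGroup.eq_zero_iff]
      exact ⟨a, rfl⟩
  haveI hfinT : Finite (A ⧸ C) := by
    haveI := finite_torsionBy_pow (A ⧸ C) p k₀
    exact Finite.of_injective (fun z : A ⧸ C ↦ (⟨z, AddSubgroup.torsionBy.nsmul_iff.mpr (hTk₀ z)⟩ :
      (A ⧸ C)[((p ^ k₀ : ℕ) : ℤ)])) (fun z w h ↦ congrArg Subtype.val h)
  -- `T ≃ L × L`
  obtain ⟨L, -, ⟨eL⟩⟩ := exists_addEquiv_prod_self B' hB'alt hB'nd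
  -- `L[p^e]` is a finite `p`-primary group: `#L[p^e] = p^{m e}`
  have hLprim : ∀ e : ℕ, ∀ x : (↥L)[((p ^ e : ℕ) : ℤ)], ∃ n : ℕ, p ^ n • x = 0 := fun e x ↦
    ⟨k₀, Subtype.ext (Subtype.ext (by
      rw [AddSubgroupClass.coe_nsmul, AddSubgroupClass.coe_nsmul, ZeroMemClass.coe_zero,
        ZeroMemClass.coe_zero]
      exact hTk₀ _))⟩
  choose m hm using fun e : ℕ ↦ exists_natCard_eq_prime_pow_of_primary p (hLprim e)
  -- `#C[p] = p ^ corank`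
  haveI : Finite C[(p : ℤ)] :=
    Finite.of_injective (torsionByMap C.subtype p) (torsionByMap_injective hi p)
  have hCp : Nat.card (C[(p : ℤ)]) = p ^ zpCorank A p := by
    rw [pow_zpCorank_eq_natCard_torsionBy_inf_range_of_stable p hA hst, natCard_torsionBy_addSubgroup,
      inf_comm]
  refine ⟨m, ?_, ?_, ⟨k₀, fun e he ↦ ?_⟩, fun e ↦ ?_⟩
  · -- `m 0 = 0`
    have h0 := hm 0
    rw [pow_zero, natCard_torsionBy_one_eq_one] at h0
    exact Nat.pow_right_injective hp.out.two_le (by rw [← h0, pow_zero] : p ^ m 0 = p ^ 0)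
  · -- monotone
    refine monotone_nat_of_le_succ fun e ↦ ?_
    rw [← Nat.pow_le_pow_iff_right hp.out.one_lt, ← hm e, ← hm (e + 1)]
    exact AddSubgroup.card_le_of_le (torsionBy_pow_mono p (Nat.le_succ e))
  · -- eventually constant: `L` is killed by `p^{k₀}`
    have htop : ∀ e', k₀ ≤ e' → Nat.card ((↥L)[((p ^ e' : ℕ) : ℤ)]) = Nat.card L := by
      intro e' he'
      have : (↥L)[((p ^ e' : ℕ) : ℤ)] = ⊤ := by
        refine eq_top_iff.mpr fun x _ ↦ torsionBy_pow_mono p he' ?_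
        exact AddSubgroup.torsionBy.nsmul_iff.mpr (Subtype.ext (by
          rw [AddSubgroupClass.coe_nsmul, ZeroMemClass.coe_zero]; exact hTk₀ _))
      rw [this, AddSubgroup.card_top]
    have hpe : p ^ m e = p ^ m k₀ := by rw [← hm e, ← hm k₀, htop e he, htop k₀ le_rfl]
    exact Nat.pow_right_injective hp.out.two_le hpe
  · -- the count at level `p^e`
    haveI : Finite (A[((p ^ e : ℕ) : ℤ)]) := finite_torsionBy_pow A p e
    have h1 : Nat.card (A[((p ^ e : ℕ) : ℤ)]) =
        Nat.card ((A ⧸ C)[((p ^ e : ℕ) : ℤ)]) * Nat.card (C[((p ^ e : ℕ) : ℤ)]) :=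
      natCard_torsionBy_eq_mul (p := p ^ e) hi hf hex hfi (hDn (p ^ e) (pow_pos hp.out.pos e))
    have h2 : Nat.card (C[((p ^ e : ℕ) : ℤ)]) = p ^ (e * zpCorank A p) := by
      rw [natCard_torsionBy_pow_eq_pow_of_pDivisible p hD e, hCp, ← pow_mul, mul_comm]
    have h3 : Nat.card ((A ⧸ C)[((p ^ e : ℕ) : ℤ)]) = p ^ (2 * m e) := by
      rw [natCard_torsionBy_congr_natCast eL (p ^ e), natCard_torsionBy_prod, hm e, ← pow_add, two_mul]
    rw [h1, h2, h3, ← pow_add, add_comm]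

end Profile

end Literature.NumberTheory.EllipticCurves

end
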